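import Literature.MathematicalPhysics.QuantumFieldTheory.BalabanImbrieJaffe1984to88.BIJ85SigmaTranslationInvariance
import Literature.MathematicalPhysics.QuantumFieldTheory.BalabanImbrieJaffe1984to88.BIJ85Eq712Plancherel
import Literature.MathematicalPhysics.QuantumFieldTheory.BalabanImbrieJaffe1984to88.BIJ85SigmaPositivity

/-!
# `BalabanImbrieJaffe1984to88.BIJ85Sigma712Torus` — T. Bałaban, J. Imbrie, A. Jaffe, *Renormalization of the Higgs model:
minimizers, propagators and the stability of mean field theory*, Commun. Math. Phys. **97** (1985) 299–329
[BalabanImbrieJaffe1985]: Sect. 7.1 p. 321 — *"σ_k is translation invariant. Thus it is natural to study σ_k as a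
multiplication operator σ_k(p) in the Fourier transform representation … (7.1.2)"* and p. 324 *"It is sufficient to show that
there is a constant c > 0 such that c ≤ σ_k(p) (7.1.22)"* — INSTANTIATED FOR THE CONFIGURATION-SPACE σ_k OF (4.2.2) ON THE
TORUS: the torus σ_k (`BIJ85Sigma421Torus.sigmaTorus`) is placed on the carrier `Tor N × m` of seat p27's
`BIJ85Eq712Plancherel`, shown `IsTranslInv` there, and p27's (7.1.2) `eq712` and "(7.1.22) ⇒ (7.1.1)" `form_re_ge_of_fibrewise`
are applied to it

statement-level skeleton of published theorems with citation tags; proofs where landed; nothing here is a claim about the Yang–Mills mass gap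

PDF held: `paper:balaban1985-cmp97-bij-higgs-minimizers` (journal page = PDF page + 298); p. 321 [PDF 23], p. 324 [PDF 26].

CITATION HEADER (lean-in-tree rule).  Part of the lit-balaban TYPED SKELETON (HOME `run/shared/lean/pub/lit-balaban/`).
WHAT IS REPRODUCED = the hook-up of SKELETON rows **C1.Thm7.1.1** / **C1.Eq7.1.2-7.1.12** (owner r15, referee ref-5) to the
MODEL σ_k of row **C1.Eq4.2.1-4.2.2**: p27 g4's `BIJ85Eq712Plancherel` proves (7.1.2) and the Plancherel passage for EVERY
translation-invariant matrix `T` on `Tor N × m → ℂ` and records *"an input for `IsTranslInv`"* = the translation invariance of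
the torus σ_k, which `BIJ85SigmaTranslationInvariance` (this seat, p251284) proves; this file supplies the dictionary and the
instances.  Phase-2 proof seat p33 gen 3 (unit `lit-balaban-p33`); TAKING line HOME/STATUS.md 2026-08-21T05:59:37Z.

THE PRINTED TEXT (verbatim, p. 321 [PDF 23]).  *"Since we study periodic boundary conditions, σ_k is translation invariant.
Thus it is natural to study σ_k as a multiplication operator σ_k(p) in the Fourier transform representation. … We introduce a
tensor notation with functions f_{μν} on plaquettes given as antisymmetric functions on coordinate axes μ, ν which indicates
plaquette orientation. They also depend on a lattice position. Then ⟨f^{(k)}, σ_kf^{(k)}⟩ = ∫_{−π}^{π}⋯∫_{−π}^{π} ⟨f̂(p),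
σ_k(p)f̂(p)⟩dp, (7.1.2)"*; p. 324 [PDF 26]: *"Proof. It is sufficient to show that there is a constant c > 0 such that
c ≤ σ_k(p) (7.1.22) for all |p_j| ≤ π."*

DICTIONARY.  The unit torus `T₁^{(k)}` = `Site P k = Fin d → ZMod (2L^{m+K−k})` of `Setup` IS p27's `Tor (torN P k)`
(`torN P k = fun _ => P.sitesPerDir k`, definitionally); "plaquette orientation μ < ν" = `Orient P`; `plaqEquiv P k : Plaq P k ≃
Tor (torN P k) × Orient P` (lattice position, orientation) carries `Plaq.translate a` to `(x + a, i)` (`plaqEquiv_symm_add`);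
a real plaquette field `f : UnitPlaqSpace P k` becomes the complex field `cvec k f`; σ_k becomes the complex matrix
`sigmaMatrix hd w c k (a, b) = ⟨δ_a, σ_kδ_b⟩` (`sigmaTorus` in the plaquette basis `EuclideanSpace.single`, for which a
`DecidableEq (Plaq P k)` instance is provided through `plaqEquiv`).

WHAT IS PROVED (0 `sorry`, standard axioms; the `def`s are the dictionary — `Orient`, `torN`, `plaqEquiv`, the `DecidableEq`
instance, `cvec`, `sigmaMatrix` — with bodies, no `Prop`):
* (private kernel `inner_eq_sum_single`: `⟨f, Tg⟩ = Σ_{p,q} f_p⟨δ_p, Tδ_q⟩g_q` on a real Euclidean space) **`form_sigmaMatrix`**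
  (`star f̃ ⬝ᵥ (sigmaMatrix *ᵥ g̃) = ⟨f, σ_kg⟩`: p27's form IS the form of (4.2.1)), `normSq_cvec` (`Σ_a |f̃(a)|² = ‖f‖²`);
* **`sigmaMatrix_isTranslInv`** — *"σ_k is translation invariant"* in p27's sense `IsTranslInv` (standing range `k ≤ m + K`,
  `η^d = w > 0`, `c ≠ 0`; from `BIJ85SigmaTranslationInvariance.sigmaTorus_matrix_translate`);
* `inner_sigmaTorus_comm`, **`sigmaMatrix_isHermitian`**, `symb_sigmaMatrix_isHermitian` (σ_k symmetric ⇒ every symbol σ_k(p)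
  Hermitian, p27's `symb_isHermitian`);
* **(7.1.2) for the torus σ_k** `eq712_sigmaTorus` (`⟨f, σ_kf⟩ = Σ_p ⟨f̂(p), σ_k(p)f̂(p)⟩`, p27's `eq712` instantiated, `σ_k(p)` =
  `symb … (sigmaMatrix …) p`);
* **"(7.1.22) ⇒ (7.1.1)" for the configuration-space σ_k on the torus** `inner_sigmaTorus_ge_of_fibrewise`: a fibrewise
  bound `c₀‖v‖² ≤ Re⟨v, σ_k(p)v⟩` at every dual momentum gives `c₀‖f‖² ≤ ⟨f, σ_kf⟩` for every real plaquette field `f` —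
  p27's `form_re_ge_of_fibrewise` transported back to `UnitPlaqSpace P k`;
* §6 the converse passage: `form_sigmaMatrix_re_ge` (complex fields `f = u + iv`: the real bound controls p27's complex form),
  `fibrewise_of_inner_sigmaTorus_ge` (p27's `fibrewise_of_form_re_ge` instantiated), and **`symb_sigmaMatrix_coercive`** —
  (7.1.22) ON EACH TORUS with a k-dependent constant: every symbol `σ_k(p)` is positive definite, `c₀(k)‖v‖² ≤ Re⟨v, σ_k(p)v⟩`
  (`c₀(k) > 0` = the coercivity constant of gen 2's `BIJ85SigmaPositivity.sigmaTorus_coercive`).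
HONEST SCOPE.  The fibrewise bound itself — the identification (7.1.13) of `symb (sigmaMatrix)` with τ₁(p) + τ₂(p) of
`BIJ85MomentumSymbols71` and the estimate (7.1.22) uniformly in k — is NOT proved here (it is the analytic content of
Proposition 7.1.2 and needs the explicit G_{k,Ax} of [Balaban1984PropagatorsI]); p10 g3's `BIJ85Thm711Fibrewise` treats the
model symbol.  One torus at a time (`P`, `k ≤ m + K` fixed): the constant of §6 depends on k; nothing about the k-UNIFORMITY of Theorem 7.1.1 / (7.1.22).
-/

namespace Literature.MathematicalPhysics.QuantumFieldTheory.BalabanImbrieJaffe1984to88.BIJ85Sigma712Torus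

open Literature.MathematicalPhysics.QuantumFieldTheory.Balaban1983to89
open B5Prop11Plancherel BIJ85Eq712Plancherel BIJ85AxialPropagator411 BIJ85SigmaForm421 BIJ85Sigma421Torus
open BIJ85SigmaTranslationInvariance BIJ85NoZeroModes309Torus
open scoped BigOperators RealInnerProductSpace Matrix ComplexConjugate

noncomputable section

variable {P : Params}

/-! ## §1  The dictionary `Plaq P k ≃ Tor N × Orient` -/

/-- The plaquette ORIENTATIONS `μ < ν` (*"antisymmetric functions on coordinate axes μ, ν which indicates plaquette
orientation"*, p. 321) — the component type `m` of p27's multi-component fields. [cite: BalabanImbrieJaffe1985, (7.1.2) p.321] -/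
abbrev Orient (P : Params) : Type := {μν : Fin P.d × Fin P.d // μν.1 < μν.2}

/-- The torus sizes of `T₁^{(k)}`: `N_μ = 2L^{m+K−k}` in every direction (`Setup`'s `sitesPerDir k`), so that p27's
`Tor (torN P k)` is `Site P k` definitionally. [cite: BalabanImbrieJaffe1985, (7.1.2) p.321] -/
abbrev torN (P : Params) (k : ℕ) : Fin P.d → ℕ := fun _ => P.sitesPerDir k

/-- *"They also depend on a lattice position"*: a plaquette of `T₁^{(k)}` = (lattice position, orientation).
[cite: BalabanImbrieJaffe1985, (7.1.2) p.321] -/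
def plaqEquiv (P : Params) (k : ℕ) : Plaq P k ≃ Tor (torN P k) × Orient P where
  toFun p := (p.src, ⟨(p.μ, p.ν), p.hμν⟩)
  invFun a := ⟨a.1, a.2.1.1, a.2.1.2, a.2.2⟩
  left_inv p := by
    obtain ⟨x, μ, ν, h⟩ := p
    rfl
  right_inv a := by
    obtain ⟨x, ⟨μ, ν⟩, h⟩ := a
    rfl

/-- `plaqEquiv` unfolded. [cite: BalabanImbrieJaffe1985, (7.1.2) p.321] -/
theorem plaqEquiv_apply (k : ℕ) (p : Plaq P k) : plaqEquiv P k p = (p.src, ⟨(p.μ, p.ν), p.hμν⟩) := rfl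

/-- `plaqEquiv.symm` unfolded. [cite: BalabanImbrieJaffe1985, (7.1.2) p.321] -/
theorem plaqEquiv_symm_apply (k : ℕ) (a : Tor (torN P k) × Orient P) :
    (plaqEquiv P k).symm a = ⟨a.1, a.2.1.1, a.2.1.2, a.2.2⟩ := rfl

/-- The translations match: the plaquette at `(x + a, i)` is the translate by `a` of the plaquette at `(x, i)`
(`TorusLimitAxioms.Plaq.translate`). [cite: BalabanImbrieJaffe1985, (7.1.2) p.321] -/
theorem plaqEquiv_symm_add (k : ℕ) (x a : Tor (torN P k)) (i : Orient P) :
    (plaqEquiv P k).symm (x + a, i) = ((plaqEquiv P k).symm (x, i)).translate a := rfl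

/-- Plaquettes have decidable equality (through `plaqEquiv`; needed for the plaquette basis `EuclideanSpace.single`). [folklore] -/
instance instDecidableEqPlaq (k : ℕ) : DecidableEq (Plaq P k) := (plaqEquiv P k).decidableEq

/-- A real plaquette field of `T₁^{(k)}` as a complex multi-component field on p27's carrier: `f̃(x, i) = f(plaquette (x, i))`.
[cite: BalabanImbrieJaffe1985, (7.1.2) p.321] -/
def cvec (k : ℕ) (f : UnitPlaqSpace P k) : Tor (torN P k) × Orient P → ℂ := fun a => ((f ((plaqEquiv P k).symm a) : ℝ) : ℂ)

/-- `cvec` unfolded. [cite: BalabanImbrieJaffe1985, (7.1.2) p.321] -/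
theorem cvec_apply (k : ℕ) (f : UnitPlaqSpace P k) (a : Tor (torN P k) × Orient P) :
    cvec k f a = ((f ((plaqEquiv P k).symm a) : ℝ) : ℂ) := rfl

/-- `Σ_a |f̃(a)|² = ‖f‖²`: p27's `normSq` is the norm of `UnitPlaqSpace P k`. [cite: BalabanImbrieJaffe1985, (7.1.1) p.321] -/
theorem normSq_cvec (k : ℕ) (f : UnitPlaqSpace P k) : ∑ a, ‖cvec k f a‖ ^ 2 = ‖f‖ ^ 2 := by
  rw [EuclideanSpace.norm_sq_eq]
  refine Fintype.sum_equiv (plaqEquiv P k).symm _ _ fun a => ?_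
  rw [cvec_apply, Complex.norm_real]

/-! ## §2  σ_k as a matrix on `Tor N × Orient`, and its translation invariance -/

/-- **σ_k ON p27's CARRIER**: the complex matrix `σ_k((x,i),(y,j)) = ⟨δ_{(x,i)}, σ_kδ_{(y,j)}⟩` of the torus σ_k
(`BIJ85Sigma421Torus.sigmaTorus hd w c k`, (4.2.2) at the torus data) in the plaquette basis. [cite: BalabanImbrieJaffe1985, (7.1.2) p.321] -/
def sigmaMatrix (hd : 2 ≤ P.d) (w c : ℝ) (k : ℕ) : Matrix (Tor (torN P k) × Orient P) (Tor (torN P k) × Orient P) ℂ :=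
  Matrix.of fun a b => ((⟪EuclideanSpace.single ((plaqEquiv P k).symm a) (1 : ℝ),
    sigmaTorus (P := P) hd w c k (EuclideanSpace.single ((plaqEquiv P k).symm b) (1 : ℝ))⟫ : ℝ) : ℂ)

/-- Entries of `sigmaMatrix`. [cite: BalabanImbrieJaffe1985, (7.1.2) p.321] -/
theorem sigmaMatrix_apply (hd : 2 ≤ P.d) (w c : ℝ) (k : ℕ) (a b : Tor (torN P k) × Orient P) :
    sigmaMatrix hd w c k a b = ((⟪EuclideanSpace.single ((plaqEquiv P k).symm a) (1 : ℝ),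
      sigmaTorus (P := P) hd w c k (EuclideanSpace.single ((plaqEquiv P k).symm b) (1 : ℝ))⟫ : ℝ) : ℂ) := rfl

/-- **"σ_k is translation invariant"** in p27's sense: `IsTranslInv (sigmaMatrix)` — `σ_k((x+a,i),(y+a,j)) = σ_k((x,i),(y,j))`
(`BIJ85SigmaTranslationInvariance.sigmaTorus_matrix_translate`; standing range `k ≤ m + K`, `η^d = w > 0`, `c ≠ 0`).
[cite: BalabanImbrieJaffe1985, (7.1.2) p.321] -/
theorem sigmaMatrix_isTranslInv (hd : 2 ≤ P.d) {k : ℕ} (hk : k ≤ P.m + P.K) {w : ℝ} (hw : 0 < w) {c : ℝ} (hc : c ≠ 0) :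
    IsTranslInv (torN P k) (Orient P) (sigmaMatrix hd w c k) := by
  intro a x y i j
  rw [sigmaMatrix_apply, sigmaMatrix_apply, plaqEquiv_symm_add, plaqEquiv_symm_add,
    sigmaTorus_matrix_translate hd hk hw hc]

/-! ## §3  The form dictionary: p27's `star f ⬝ᵥ (T *ᵥ f)` is the form `⟨f, σ_kf⟩` of (4.2.1) -/

/-- kernel: on a real Euclidean space, `⟨f, Tg⟩ = Σ_p Σ_q f_p ⟨δ_p, Tδ_q⟩ g_q` (matrix of `T` in the coordinate basis). [folklore] -/
private theorem inner_eq_sum_single {ι : Type*} [Fintype ι] [DecidableEq ι] (T : EuclideanSpace ℝ ι →ₗ[ℝ] EuclideanSpace ℝ ι)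
    (f g : EuclideanSpace ℝ ι) :
    ⟪f, T g⟫ = ∑ p, ∑ q, f p * ⟪EuclideanSpace.single p (1 : ℝ), T (EuclideanSpace.single q (1 : ℝ))⟫ * g q := by
  have hrepr : ∀ v : EuclideanSpace ℝ ι, v = ∑ q, v q • EuclideanSpace.single q (1 : ℝ) := by
    intro v
    conv_lhs => rw [← (EuclideanSpace.basisFun ι ℝ).sum_repr v]
    simp only [EuclideanSpace.basisFun_repr, EuclideanSpace.basisFun_apply]
  conv_lhs => rw [hrepr f, hrepr g]
  simp only [map_sum, map_smul, sum_inner, inner_sum, real_inner_smul_left, real_inner_smul_right]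
  rw [Finset.sum_comm]
  refine Finset.sum_congr rfl fun p _ => Finset.sum_congr rfl fun q _ => ?_
  ring

/-- **p27's form is the form of (4.2.1)**: `star f̃ ⬝ᵥ (sigmaMatrix *ᵥ g̃) = ⟨f, σ_kg⟩` for real plaquette fields `f, g`.
[cite: BalabanImbrieJaffe1985, (7.1.2) p.321] -/
theorem form_sigmaMatrix (hd : 2 ≤ P.d) (w c : ℝ) (k : ℕ) (f g : UnitPlaqSpace P k) :
    star (cvec k f) ⬝ᵥ (sigmaMatrix hd w c k *ᵥ cvec k g) = ((⟪f, sigmaTorus (P := P) hd w c k g⟫ : ℝ) : ℂ) := by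
  rw [inner_eq_sum_single]
  push_cast
  simp only [dotProduct, Matrix.mulVec, cvec_apply, sigmaMatrix_apply, Pi.star_apply, Complex.star_def,
    Complex.conj_ofReal, Finset.mul_sum]
  symm
  refine Fintype.sum_equiv (plaqEquiv P k) _ _ fun p => ?_
  refine Fintype.sum_equiv (plaqEquiv P k) _ _ fun q => ?_
  simp only [Equiv.symm_apply_apply]
  ring

/-! ## §4  σ_k symmetric: the matrix is Hermitian, every symbol σ_k(p) is Hermitian -/

/-- `σ_k` is a symmetric operator: `⟨σ_kf, g⟩ = ⟨f, σ_kg⟩` (`σ_k = Q^e_k(I − ∂G_{k,Ax}∂^*)Q^{e*}_k` with `∂G_{k,Ax}∂^*` symmetric,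
p09's `curlG_symm`; no zero modes from gen 2's `noZeroModes_V411_holds`). [cite: BalabanImbrieJaffe1985, (4.2.2) p.310] -/
theorem inner_sigmaTorus_comm (hd : 2 ≤ P.d) {k : ℕ} (hk : k ≤ P.m + P.K) {w : ℝ} (hw : 0 < w) {c : ℝ} (hc : c ≠ 0)
    (f g : UnitPlaqSpace P k) :
    ⟪sigmaTorus (P := P) hd w c k f, g⟫ = ⟪f, sigmaTorus (P := P) hd w c k g⟫ := by
  unfold sigmaTorus sigmaOp
  simp only [LinearMap.comp_apply, LinearMap.sub_apply, LinearMap.id_apply, LinearMap.adjoint_inner_left,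
    LinearMap.adjoint_inner_right, inner_sub_left, inner_sub_right, curlG_symm (noZeroModes_V411_holds hk hw hc)]

/-- **`sigmaMatrix` is Hermitian** (real symmetric). [cite: BalabanImbrieJaffe1985, (7.1.2) p.321] -/
theorem sigmaMatrix_isHermitian (hd : 2 ≤ P.d) {k : ℕ} (hk : k ≤ P.m + P.K) {w : ℝ} (hw : 0 < w) {c : ℝ} (hc : c ≠ 0) :
    (sigmaMatrix hd w c k).IsHermitian := by
  refine Matrix.IsHermitian.ext fun a b => ?_
  rw [sigmaMatrix_apply, sigmaMatrix_apply, Complex.star_def, Complex.conj_ofReal, ← inner_sigmaTorus_comm hd hk hw hc,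
    real_inner_comm]

/-- **Every symbol `σ_k(p)` is Hermitian** (p27's `symb_isHermitian` instantiated). [cite: BalabanImbrieJaffe1985, (7.1.2) p.321] -/
theorem symb_sigmaMatrix_isHermitian (hd : 2 ≤ P.d) {k : ℕ} (hk : k ≤ P.m + P.K) {w : ℝ} (hw : 0 < w) {c : ℝ} (hc : c ≠ 0)
    (p : Tor (torN P k)) : (symb (torN P k) (Orient P) (sigmaMatrix hd w c k) p).IsHermitian :=
  symb_isHermitian (torN P k) (Orient P) (sigmaMatrix_isTranslInv hd hk hw hc) (sigmaMatrix_isHermitian hd hk hw hc) p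

/-! ## §5  (7.1.2) and "(7.1.22) ⇒ (7.1.1)" for the torus σ_k -/

/-- **(7.1.2) FOR THE TORUS σ_k**: `⟨f, σ_kf⟩ = Σ_p ⟨f̂(p), σ_k(p)f̂(p)⟩` — p27's `eq712` at `T = sigmaMatrix`, `σ_k(p)` = its
symbol `symb`, `f̂ = (F⊗1)f` (`dftC`). [cite: BalabanImbrieJaffe1985, (7.1.2) p.321] -/
theorem eq712_sigmaTorus (hd : 2 ≤ P.d) {k : ℕ} (hk : k ≤ P.m + P.K) {w : ℝ} (hw : 0 < w) {c : ℝ} (hc : c ≠ 0)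
    (f : Tor (torN P k) × Orient P → ℂ) :
    star f ⬝ᵥ (sigmaMatrix hd w c k *ᵥ f) =
      ∑ p : Tor (torN P k), star (fun i => (dftC (torN P k) (Orient P) *ᵥ f) (p, i)) ⬝ᵥ
        (symb (torN P k) (Orient P) (sigmaMatrix hd w c k) p *ᵥ fun i => (dftC (torN P k) (Orient P) *ᵥ f) (p, i)) :=
  eq712 (torN P k) (Orient P) (sigmaMatrix_isTranslInv hd hk hw hc) f

/-- … and for a real plaquette field, the left side is the form of (4.2.1): `⟨f, σ_kf⟩ = Σ_p ⟨f̂(p), σ_k(p)f̂(p)⟩` with `f̂` the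
transform of `f̃ = cvec k f`. [cite: BalabanImbrieJaffe1985, (7.1.2) p.321] -/
theorem inner_sigmaTorus_eq712 (hd : 2 ≤ P.d) {k : ℕ} (hk : k ≤ P.m + P.K) {w : ℝ} (hw : 0 < w) {c : ℝ} (hc : c ≠ 0)
    (f : UnitPlaqSpace P k) :
    ((⟪f, sigmaTorus (P := P) hd w c k f⟫ : ℝ) : ℂ) =
      ∑ p : Tor (torN P k), star (fun i => (dftC (torN P k) (Orient P) *ᵥ cvec k f) (p, i)) ⬝ᵥ
        (symb (torN P k) (Orient P) (sigmaMatrix hd w c k) p *ᵥ fun i => (dftC (torN P k) (Orient P) *ᵥ cvec k f) (p, i)) := by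
  rw [← form_sigmaMatrix, eq712_sigmaTorus hd hk hw hc]

/-- **"(7.1.22) ⇒ (7.1.1)" FOR THE CONFIGURATION-SPACE σ_k ON THE TORUS** (*"It is sufficient to show that there is a constant
c > 0 such that c ≤ σ_k(p)"*): a fibrewise lower bound `c₀‖v‖² ≤ Re⟨v, σ_k(p)v⟩` at every dual momentum `p` of `T₁^{(k)}` gives
`c₀‖f‖² ≤ ⟨f, σ_kf⟩` for every real plaquette field — p27's `form_re_ge_of_fibrewise` transported to `UnitPlaqSpace P k` by
the dictionary of §3. [cite: BalabanImbrieJaffe1985, Prop. 7.1.2 (7.1.22) p.324] -/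
theorem inner_sigmaTorus_ge_of_fibrewise (hd : 2 ≤ P.d) {k : ℕ} (hk : k ≤ P.m + P.K) {w : ℝ} (hw : 0 < w) {c : ℝ}
    (hc : c ≠ 0) {c₀ : ℝ}
    (hfib : ∀ (p : Tor (torN P k)) (v : Orient P → ℂ),
      c₀ * ∑ i, ‖v i‖ ^ 2 ≤ (star v ⬝ᵥ (symb (torN P k) (Orient P) (sigmaMatrix hd w c k) p *ᵥ v)).re)
    (f : UnitPlaqSpace P k) :
    c₀ * ‖f‖ ^ 2 ≤ ⟪f, sigmaTorus (P := P) hd w c k f⟫ := by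
  have h := form_re_ge_of_fibrewise (torN P k) (Orient P) (sigmaMatrix_isTranslInv hd hk hw hc) hfib (cvec k f)
  rwa [form_sigmaMatrix, Complex.ofReal_re, normSq_cvec] at h

/-! ## §6  The converse passage and (7.1.22) on each torus: every symbol `σ_k(p)` is positive definite -/

/-- kernel: `Re( conj z · (r · w) ) = r (Re z Re w + Im z Im w)` for real `r`. [folklore] -/
private theorem re_conj_mul_ofReal_mul (z w : ℂ) (r : ℝ) :
    (conj z * ((r : ℂ) * w)).re = r * (z.re * w.re + z.im * w.im) := by
  simp only [Complex.mul_re, Complex.conj_re, Complex.conj_im, Complex.ofReal_re, Complex.ofReal_im, Complex.mul_im]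
  ring

/-- **The real form controls the complex form**: for a complex multi-component field `f = u + iv` (`u`, `v` real plaquette
fields), `Re(star f ⬝ᵥ (sigmaMatrix *ᵥ f)) = ⟨u, σ_ku⟩ + ⟨v, σ_kv⟩` and `Σ_a |f(a)|² = ‖u‖² + ‖v‖²`; hence a configuration-space
bound `c₀‖g‖² ≤ ⟨g, σ_kg⟩` for REAL fields gives p27's complex bound `c₀Σ_a|f(a)|² ≤ Re(star f ⬝ᵥ (sigmaMatrix *ᵥ f))`.
[cite: BalabanImbrieJaffe1985, Prop. 7.1.2 (7.1.22) p.324] -/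
theorem form_sigmaMatrix_re_ge (hd : 2 ≤ P.d) (w c : ℝ) (k : ℕ) {c₀ : ℝ}
    (h : ∀ g : UnitPlaqSpace P k, c₀ * ‖g‖ ^ 2 ≤ ⟪g, sigmaTorus (P := P) hd w c k g⟫)
    (f : Tor (torN P k) × Orient P → ℂ) :
    c₀ * ∑ a, ‖f a‖ ^ 2 ≤ (star f ⬝ᵥ (sigmaMatrix hd w c k *ᵥ f)).re := by
  -- `f = u + iv` with `u`, `v` real plaquette fields
  let u : UnitPlaqSpace P k := toU P k fun q => (f (plaqEquiv P k q)).re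
  let v : UnitPlaqSpace P k := toU P k fun q => (f (plaqEquiv P k q)).im
  have hu : ∀ q, u q = (f (plaqEquiv P k q)).re := fun q => rfl
  have hv : ∀ q, v q = (f (plaqEquiv P k q)).im := fun q => rfl
  -- the norm splits
  have hnorm : ∑ a, ‖f a‖ ^ 2 = ‖u‖ ^ 2 + ‖v‖ ^ 2 := by
    rw [EuclideanSpace.norm_sq_eq, EuclideanSpace.norm_sq_eq, ← Finset.sum_add_distrib]
    refine Fintype.sum_equiv (plaqEquiv P k).symm _ _ fun a => ?_
    rw [hu, hv, Equiv.apply_symm_apply, Real.norm_eq_abs, Real.norm_eq_abs, sq_abs, sq_abs, Complex.sq_norm,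
      Complex.normSq_apply]
    ring
  -- the form splits
  have hform : (star f ⬝ᵥ (sigmaMatrix hd w c k *ᵥ f)).re =
      ⟪u, sigmaTorus (P := P) hd w c k u⟫ + ⟪v, sigmaTorus (P := P) hd w c k v⟫ := by
    rw [inner_eq_sum_single, inner_eq_sum_single, ← Finset.sum_add_distrib]
    simp only [dotProduct, Matrix.mulVec, sigmaMatrix_apply, Pi.star_apply, Complex.star_def, Finset.mul_sum,
      Complex.re_sum, re_conj_mul_ofReal_mul, ← Finset.sum_add_distrib]
    refine Fintype.sum_equiv (plaqEquiv P k).symm _ _ fun a => Fintype.sum_equiv (plaqEquiv P k).symm _ _ fun b => ?_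
    rw [hu, hu, hv, hv, Equiv.apply_symm_apply, Equiv.apply_symm_apply]
    ring
  rw [hnorm, hform, mul_add]
  exact add_le_add (h u) (h v)

/-- **The converse passage for the torus σ_k**: a configuration-space bound `c₀‖g‖² ≤ ⟨g, σ_kg⟩` for all real plaquette fields
forces the fibrewise bound `c₀‖v‖² ≤ Re⟨v, σ_k(p)v⟩` at EVERY dual momentum `p` (p27's `fibrewise_of_form_re_ge`: on a finite torus
the constant of (7.1.1) is the worst fibre constant of (7.1.22)). [cite: BalabanImbrieJaffe1985, Prop. 7.1.2 (7.1.22) p.324] -/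
theorem fibrewise_of_inner_sigmaTorus_ge (hd : 2 ≤ P.d) {k : ℕ} (hk : k ≤ P.m + P.K) {w : ℝ} (hw : 0 < w) {c : ℝ}
    (hc : c ≠ 0) {c₀ : ℝ} (h : ∀ g : UnitPlaqSpace P k, c₀ * ‖g‖ ^ 2 ≤ ⟪g, sigmaTorus (P := P) hd w c k g⟫)
    (p : Tor (torN P k)) (v : Orient P → ℂ) :
    c₀ * ∑ i, ‖v i‖ ^ 2 ≤ (star v ⬝ᵥ (symb (torN P k) (Orient P) (sigmaMatrix hd w c k) p *ᵥ v)).re :=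
  fibrewise_of_form_re_ge (torN P k) (Orient P) (sigmaMatrix_isTranslInv hd hk hw hc)
    (form_sigmaMatrix_re_ge hd w c k h) p v

/-- **(7.1.22) ON EACH TORUS, with a k-DEPENDENT constant**: for every `k ≤ m + K` there is `c₀ > 0` (the coercivity constant of
σ_k on `T₁^{(k)}`, gen 2's `BIJ85SigmaPositivity.sigmaTorus_coercive`, from *"σ_k is strictly positive"*) with
`c₀‖v‖² ≤ Re⟨v, σ_k(p)v⟩` for every dual momentum `p` and every `v` — every symbol `σ_k(p)` is positive definite.  (The printed
(7.1.22) asserts ONE `c` for all k; that uniformity is the analytic content of Proposition 7.1.2 and is NOT proved here.)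
[cite: BalabanImbrieJaffe1985, Prop. 7.1.2 (7.1.22) p.324] -/
theorem symb_sigmaMatrix_coercive (hd : 2 ≤ P.d) {k : ℕ} (hk : k ≤ P.m + P.K) {w : ℝ} (hw : 0 < w) {c : ℝ} (hc : c ≠ 0) :
    ∃ c₀ : ℝ, 0 < c₀ ∧ ∀ (p : Tor (torN P k)) (v : Orient P → ℂ),
      c₀ * ∑ i, ‖v i‖ ^ 2 ≤ (star v ⬝ᵥ (symb (torN P k) (Orient P) (sigmaMatrix hd w c k) p *ᵥ v)).re := by
  obtain ⟨c₀, hc₀, h⟩ := BIJ85SigmaPositivity.sigmaTorus_coercive (P := P) hd hk hw hc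
  exact ⟨c₀, hc₀, fibrewise_of_inner_sigmaTorus_ge hd hk hw hc h⟩

end

end Literature.MathematicalPhysics.QuantumFieldTheory.BalabanImbrieJaffe1984to88.BIJ85Sigma712Torus
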